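import Literature.AlgebraicGeometry.Frobenioids.UnitTrivializationBiratCompactComparison
import Literature.AlgebraicGeometry.Frobenioids.BirationalizationFrobenioidGeneral
import HarnessLib

/-!
# Frobenioids I, Proposition 5.5 (iii): "if `C` is of … rationally standard … type, then so is `C^pf`" — the
# slot of `Prop55Sub.lean` at the canonical support, CLOSED from the slot's own hypotheses (abc-iut cell,
# layer L1, node `FrdI:Prop5.5(iii)`, sub-DAG row `FrdI:Prop5.5(iii)/P55-L06`, slot `FrdI.Prop55Sub.Prop55iii_pf_ratStd`)

Mochizuki, *The geometry of Frobenioids I: the general theory*, Kyushu J. Math. **62** (2008)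
293–400, §5, Proposition 5.5 (iii), kurims text p. 104 ll. 36–37, proof p. 105 ll. 11–20; Def. 4.5 (iii)
p. 86. [cite: MochizukiFrdI2008, Prop. 5.5 (iii) p.104]

PROOF-ONLY assembly (no definitions).  The four clauses of Def. 4.5 (iii) for THE perfection `C^pf → F_{Φ^pf}`
from the corresponding clauses for `C`, every input a landed theorem:
* (a) birationally Frobenius-normalized — seat abc-iut-w5-d042's
  `PerfectionBirat.isOfBiratFrobeniusNormalizedType_biratData_perfection` (GIVEN "`C^birat` is a Frobenioid",
  Prop. 4.4 (ii), hypothesis `hBi` — itself a theorem for isotropic `C`, seat abc-iut-w5-d227);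
* (a) rational — this seat's `Perfection.isRational_perfection_of` (`PerfectionRational.lean`);
* (a) standard — seats abc-iut-w5-d042 / w5-d190 / L1-d9: `prop55iii_pf_standard_of_prop55i` with Prop. 5.5 (i)
  `prop55i_holds`; Prop. 3.2 (iii) is the slot's own binder `hPf`;
* (b) "`((C^pf)^un-tr)^birat` admits a Frobenius-compact object" — seat abc-iut-w5-d250's
  `Perfection.exists_isFrobeniusCompact_untrBirat_of_untr` (λ-rigidity of `Φ^birat` transported up
  `Φ^gp → (Φ^pf)^gp`, seats abc-iut-L1-t2 / w5-d250, over this seat's `map_mem_biratSubgroup_perfection` /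
  `monGpMap_perfectionOf_pullGp`) from clause (b) for `C`.
Result: `FrdI.Prop55Sub.prop55iii_pf_ratStd_primarySupp_holds_of_isFrobenioid_birat hF hBi` (CONDITIONAL on
Prop. 4.4 (ii) only) and `FrdI.Prop55Sub.prop55iii_pf_ratStd_primarySupp_holds hF hiso` — the slot
`Prop55iii_pf_ratStd F hF PrimarySupp PrimarySupp` for every Frobenioid of ISOTROPIC type, i.e. under print's
standing hypothesis of Def. 2.7 / 4.5 (i) and nothing else.  (For an arbitrary unrelated `SuppPf` the slot is not
closable, as for GAP row P55iii-F1; `PrimarySupp` is THE support of Def. 2.4 (i)(d), seat abc-iut-w5-d250.)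
No statement of the paper is strengthened; nothing here bears on [IUTchIII] Cor. 3.12.
-/

namespace Literature.AlgebraicGeometry.Frobenioids

open CategoryTheory Opposite

universe w v v' u u'

namespace FrdI.Prop55Sub

open PreFrobenioid

variable {D : Type u} [Category.{v} D] {Φ : Dᵒᵖ ⥤ CommMonCat.{w}}
  {C : Type u'} [Category.{v'} C] {F : C ⥤ ElemFrobenioid Φ}

/-- **Proposition 5.5 (iii), "if `C` is of … rationally standard … type, then so is `C^pf`"**, the slot
`Prop55iii_pf_ratStd F hF Supp SuppPf` AT THE CANONICAL SUPPORT (`PrimarySupp` twice), GIVEN ONLY "`C^birat` is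
a Frobenioid" (Prop. 4.4 (ii), `hBi`, cone node `FrdI:Prop4.4(ii)`): Def. 4.5 (iii)(a) — birationally
Frobenius-normalized, rational, standard — and (b) for `C^pf`, each from the corresponding clause for `C`;
Prop. 3.2 (iii) is the slot's own binder `hPf`. [cite: MochizukiFrdI2008, Prop. 5.5 (iii) p.104] -/
theorem prop55iii_pf_ratStd_primarySupp_holds_of_isFrobenioid_birat (hF : IsFrobenioid F)
    (hBi : IsFrobenioid (biratOps hF (hasBiratSquares_of_isFrobenioid hF)).toFunctor) :
    Prop55iii_pf_ratStd F hF (fun a 𝔭 => PrimarySupp a 𝔭) (fun a 𝔭 => PrimarySupp a 𝔭) := by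
  intro hfi hfn hPf hR
  exact
    { biratFrobNormalized := PerfectionBirat.isOfBiratFrobeniusNormalizedType_biratData_perfection hPf
        (hasBiratSquares_of_isFrobenioid hPf) hBi hR.biratFrobNormalized
      rational := Perfection.isRational_perfection_of hF hPf hR.rational
      standard := prop55iii_pf_standard_of_prop55i hF hPf (fun A => prop55i_holds hF A) hfi hfn hR.standard
      frobCompact := Perfection.exists_isFrobeniusCompact_untrBirat_of_untr hF hPf hfi hR.frobCompact }

/-- **The same for `C` of ISOTROPIC type, NO further hypothesis**: Prop. 4.4 (ii) discharged by seat
abc-iut-w5-d227's `isFrobenioid_biratData_ops_toFunctor'` from the slot's own birational Frobenius-normalization of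
`C`.  `Prop55iii_pf_ratStd F hF PrimarySupp PrimarySupp` CONDITIONAL only on print's standing hypothesis "`C` of
isotropic type" (Def. 2.7 / 4.5 (i)). [cite: MochizukiFrdI2008, Prop. 5.5 (iii) p.104] -/
theorem prop55iii_pf_ratStd_primarySupp_holds (hF : IsFrobenioid F) (hiso : IsOfIsotropicType F) :
    Prop55iii_pf_ratStd F hF (fun a 𝔭 => PrimarySupp a 𝔭) (fun a 𝔭 => PrimarySupp a 𝔭) :=
  fun hfi hfn hPf hR =>
    prop55iii_pf_ratStd_primarySupp_holds_of_isFrobenioid_birat hF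
      (isFrobenioid_biratData_ops_toFunctor' hF hiso fun A =>
        (isBiratFrobeniusNormalized_iff_biratData A).mpr (hR.biratFrobNormalized.obj A))
      hfi hfn hPf hR

/-- **Proposition 5.5 (iii), "if `C` is of … rationally standard … type, then so is `C^pf`" — the slot
`Prop55iii_pf_ratStd F hF PrimarySupp PrimarySupp` for EVERY Frobenioid `C`, NO further hypothesis**: the one
named input "`C^birat` is a Frobenioid" (Prop. 4.4 (ii)) of
`prop55iii_pf_ratStd_primarySupp_holds_of_isFrobenioid_birat` is supplied WITHOUT isotropy by seat
abc-iut-L6-t20's general `isFrobenioid_biratOps_toFunctor_general` from the slot's OWN hypothesis that `C` is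
of birationally Frobenius-normalized type (clause (a) of "rationally standard", through the bridge
`isBiratFrobeniusNormalized_iff_biratData`).  The isotropy residual of `prop55iii_pf_ratStd_primarySupp_holds`
is gone; with seat abc-iut-L6-t6's `prop55iii_pf_model_holds` every named `Prop55Sub` slot of Prop. 5.5 (iii)
for `C^pf` is now closed at the canonical support. [cite: MochizukiFrdI2008, Prop. 5.5 (iii) p.104] -/
theorem prop55iii_pf_ratStd_holds (hF : IsFrobenioid F) :
    Prop55iii_pf_ratStd F hF (fun a 𝔭 => PrimarySupp a 𝔭) (fun a 𝔭 => PrimarySupp a 𝔭) :=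
  fun hfi hfn hPf hR =>
    prop55iii_pf_ratStd_primarySupp_holds_of_isFrobenioid_birat hF
      (isFrobenioid_biratOps_toFunctor_general hF _ fun A =>
        (isBiratFrobeniusNormalized_iff_biratData A).mpr (hR.biratFrobNormalized.obj A))
      hfi hfn hPf hR

end FrdI.Prop55Sub

end Literature.AlgebraicGeometry.Frobenioids
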